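import Literature.MathematicalPhysics.KineticTheory.LangevinChainLimitFlow
import Literature.MathematicalPhysics.KineticTheory.LangevinChainEnergyScale
import HarnessLib

/-!
# The rescaled driven chain stays close to the limit flow: the high-energy dissipation bound, interaction regime (CEHR Prop. 5.3 / §5.1)

Trunk T-KINETIC (Literature/MathematicalPhysics/KineticTheory). Deterministic layer of the
provefact unit for `CuneoEckmannHairerReyBellet2018_H2` (CEHR Theorem 5.1 / Remark 5.2),
continuing `LangevinChainEnergyScale.lean` (energy at scale `K⁴`), `LangevinChainScalingLimit.lean`
(the rescaled chains `scaledChain`, the scaling map `rescale`, the scaling identities) and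
`LangevinChainLimitFlow.lean` (the limit flow and Prop. 5.14 for all `lam ≥ 0`).
Cuneo–Eckmann–Hairer–Rey-Bellet, EJP 23 (2018) no. 55, §5.1 (arXiv pp. 12–15): in the rescaled
variables (5.7) the driven chain solves (5.8), whose drift differs from the limit system (5.10) by
`R̃_v → 0` (5.12) plus the vanishing friction and noise; Lemma 5.17 (Grönwall, Lemma 5.8) makes the
rescaled path and the limit solution close, and Prop. 5.14 then bounds the dissipation below
(proof of Prop. 5.3, p. 15). Here everything is PATHWISE (the noise is a continuous path of size
`≤ δ₀K` over the window `[0, Λ/K]`), for the pinned chain with `ω₂ > 0`, `lam ≥ 0`, `β > 0`: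

* `rescaleL`, `scalePath`, `scaledDrift`, `inv_smul_rescale_drift`, `scalePath_eq` — the scaling map
  as a continuous linear map, the rescaled path `z̃(σ) = rescale K (z(σ/K))`, the rescaled drift
  `Ỹ_K = (p̃, -∇Φ̃_{K⁻²} - (γ/K)wp̃)` and **the rescaled integral equation**
  `z̃(σ) = x̃ + (0, K⁻²η(σ/K)) + ∫₀^σ Ỹ_K(z̃)` ((5.8), from the integral equation of `chainFlow`).
* `scaleRegion`, `lipschitzOnWith_limitChain_drift` — the region `{|p̃ᵢ| ≤ Cp, |δq̃| ≤ Cd,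
  lam q̃ᵢ² ≤ Cq}` (positions enter only through `lam q²`, so `lam = 0` is allowed) and the Lipschitz
  constant `1 + 3Cq + 12βCd²` of the limit drift there.
* `norm_scaledDrift_sub_drift_le` — **the perturbation is `O(1/K)`**: `‖Ỹ_K - Ŷ‖ ≤ (2c₁ + ω₂ + 2Cd
  + 2γCp)/K` on the region (the harmonic forces `K⁻²(ω₂q̃, δq̃)`, (5.12), and the friction `γ/K`).
* `shiftVec`, `limitChain_drift_shift`, `limitChain_hamiltonian_shift` — translation invariance of
  the limit system when `lam·c = 0` (the reduction "compact modulo translations", proof of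
  Prop. 5.14, case `ℓ_i > ℓ_p`).
* `scalePath_bounds`, `limitChainFlow_shift_bounds` — both paths live in the region (energy
  ceiling of `LangevinChainEnergyScale.lean`, resp. exact conservation), (5.9).
* `pinnedChain_dissipation_ge_interaction` — **the dissipation bound in the interaction regime**:
  for `Λ > 0`, `δ₀ ∈ (0,1]` with `Aδ₀Λ ≤ 1` there are `K₀, ε > 0` such that for `K ≥ K₀`,
  `H(x) ≤ 2K⁴`, `Ĥ(rescale K x) ≥ 1/2` and `‖η‖ ≤ δ₀K` on `[0, Λ/K]`,
  `γ∫₀^{Λ/K} ∑ᵢ wᵢ ȳᵢ² ds ≥ εK³` (Prop. 5.3 in the case of §5.1, with the explicit rate replacing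
  the probability estimate: the bad event is handled by the caller through the noise size).

## References

* N. Cuneo, J.-P. Eckmann, M. Hairer, L. Rey-Bellet, *Non-equilibrium steady states for networks
  of oscillators*, EJP 23 (2018) no. 55 (arXiv:1712.09413), §5.1: (5.7)–(5.12), Lemma 5.8,
  Lemma 5.13, Prop. 5.14, Lemma 5.17, and the proof of Prop. 5.3 on p. 15.
* E. A. Coddington, N. Levinson, *Theory of Ordinary Differential Equations* (1955), Ch. 1 §5
  (Grönwall), through `Literature.Analysis.ODE.IsIntegralSolutionOn.norm_sub_le_mul_exp`.
-/

noncomputable section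

open MeasureTheory Filter Topology Set Metric Function
open scoped NNReal

namespace Literature.MathematicalPhysics.KineticTheory.HeatConduction

open OscillatorChain Literature.Analysis.ODE

variable {N : ℕ}

/-! ### The scaling map as a continuous linear map; the rescaled integral equation -/

/-- The scaling map `(q, p) ↦ (K⁻¹q, K⁻²p)` as a continuous linear map (it is `OscillatorChain.rescale K`
pointwise, `rescaleL_apply`). [cite: CuneoEckmannHairerReyBellet2018, §5.1 eq. (5.7)] -/
def rescaleL (K : ℝ) : PhaseSpace N →L[ℝ] PhaseSpace N :=
  (K⁻¹ • ContinuousLinearMap.fst ℝ (Fin N → ℝ) (Fin N → ℝ)).prod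
    ((K ^ 2)⁻¹ • ContinuousLinearMap.snd ℝ (Fin N → ℝ) (Fin N → ℝ))

/-- `rescaleL K z = rescale K z`. [folklore] -/
@[simp] theorem rescaleL_apply (K : ℝ) (z : PhaseSpace N) : rescaleL K z = rescale K z := by
  ext i <;> simp [rescaleL, rescale]

/-- The **rescaled path** `z̃(σ) = rescale K (z(σ/K))` (CEHR (5.7): `p̃(σ) = E^{-1/2}p(E^{-1/4}σ)`,
`q̃(σ) = E^{-1/4}q(E^{-1/4}σ)`, `E = K⁴`). [cite: CuneoEckmannHairerReyBellet2018, §5.1 eq. (5.7)] -/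
def scalePath (K : ℝ) (z : ℝ → PhaseSpace N) (σ : ℝ) : PhaseSpace N := rescale K (z (σ / K))

/-- The rescaled path is continuous if the path is. [folklore] -/
theorem continuous_scalePath (K : ℝ) {z : ℝ → PhaseSpace N} (hz : Continuous z) :
    Continuous (scalePath K z) :=
  (continuous_rescale K).comp (hz.comp (continuous_id.div_const K))

/-- The **rescaled drift** of the pinned chain at scale `K`: `Ỹ_K(q̃, p̃) = (p̃, -∇Φ̃_{K⁻²}(q̃) - (γ/K) w p̃)`
(CEHR (5.8): the rescaled system, with the friction `E^{1/ℓ_i-1/2}γ = γ/K`).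
[cite: CuneoEckmannHairerReyBellet2018, §5.1 eq. (5.8)] -/
def scaledDrift (ω₂ lam β γ : ℝ) (N : ℕ) (K : ℝ) (z : PhaseSpace N) : PhaseSpace N :=
  (z.2, fun i => -(scaledChain ω₂ lam β (K ^ 2)⁻¹).dPotential N i z.1 - γ / K * bathWeight N i * z.2 i)

section RescaledEquation

variable {ω₂ lam β γ : ℝ}

/-- **The drift rescales to the rescaled drift**: `K⁻¹ • rescale K (Y(z)) = Ỹ_K(rescale K z)` for the
pinned chain (`K ≠ 0`; the force scales like `K³`, `pinnedChain_dPotential_eq_scaled`).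
[cite: CuneoEckmannHairerReyBellet2018, §5.1 eq. (5.8)] -/
theorem inv_smul_rescale_drift {K : ℝ} (hK : K ≠ 0) (z : PhaseSpace N) :
    K⁻¹ • rescale K ((pinnedChain ω₂ lam β γ).drift N z) = scaledDrift ω₂ lam β γ N K (rescale K z) := by
  have hUd : Differentiable ℝ (pinnedChain ω₂ lam β γ).U :=
    (pinnedChain_contDiff_U ω₂ lam β γ (n := 1)).differentiable one_ne_zero
  have hVd : Differentiable ℝ (pinnedChain ω₂ lam β γ).V :=
    (pinnedChain_contDiff_V ω₂ lam β γ (n := 1)).differentiable one_ne_zero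
  ext i
  · simp only [Prod.smul_fst, Pi.smul_apply, rescale_fst, OscillatorChain.drift, smul_eq_mul, scaledDrift,
      rescale_snd]
    rw [sq]
    ring
  · simp only [Prod.smul_snd, Pi.smul_apply, rescale_snd, OscillatorChain.drift, smul_eq_mul, scaledDrift,
      (pinnedChain ω₂ lam β γ).partialQ_hamiltonian_eq_dPotential hUd hVd]
    have h := pinnedChain_dPotential_eq_scaled ω₂ lam β γ hK N i z.1
    have hγ : (pinnedChain ω₂ lam β γ).γ = γ := rfl
    have h' : (rescale K z).1 = fun j => K⁻¹ * z.1 j := rfl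
    rw [hγ, h', ← h]
    field_simp

/-- **The rescaled integral equation**: if `z(s) = x + (0, η(s)) + ∫₀ˢ Y(z)` on `[0, Λ/K]` (the
driven pinned chain, `LangevinChainSDE.lean`), then on `[0, Λ]`
`z̃(σ) = x̃ + (0, K⁻²η(σ/K)) + ∫₀^σ Ỹ_K(z̃(σ')) dσ'` (`z̃ = scalePath K z`, `x̃ = rescale K x`).
[cite: CuneoEckmannHairerReyBellet2018, §5.1 eq. (5.8)] -/
theorem scalePath_eq {K : ℝ} (hK : 0 < K) {x : PhaseSpace N} {η : ℝ → Fin N → ℝ}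
    {z : ℝ → PhaseSpace N} (hzc : Continuous z) {Λ : ℝ}
    (hz : ∀ s ∈ Icc 0 (Λ / K), z s = x + ((0 : Fin N → ℝ), η s) +
      ∫ r in (0 : ℝ)..s, (pinnedChain ω₂ lam β γ).drift N (z r))
    {σ : ℝ} (hσ : σ ∈ Icc 0 Λ) :
    scalePath K z σ = rescale K x + ((0 : Fin N → ℝ), fun i => (K ^ 2)⁻¹ * η (σ / K) i) +
      ∫ r in (0 : ℝ)..σ, scaledDrift ω₂ lam β γ N K (scalePath K z r) := by
  set P := pinnedChain ω₂ lam β γ with hP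
  have hYc : Continuous (P.drift N) := (pinnedChain_contDiff_drift ω₂ lam β γ N (n := 0)).continuous
  have hσK : σ / K ∈ Icc 0 (Λ / K) := ⟨div_nonneg hσ.1 hK.le, div_le_div_of_nonneg_right hσ.2 hK.le⟩
  unfold scalePath
  rw [hz (σ / K) hσK, rescale_add, rescale_add]
  have h1 : rescale K (((0 : Fin N → ℝ), η (σ / K)) : PhaseSpace N) =
      ((0 : Fin N → ℝ), fun i => (K ^ 2)⁻¹ * η (σ / K) i) := by
    ext i <;> simp [rescale]
  have h2 : rescale K (∫ r in (0 : ℝ)..σ / K, P.drift N (z r)) =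
      ∫ r in (0 : ℝ)..σ / K, rescale K (P.drift N (z r)) := by
    have hint : IntervalIntegrable (fun r => P.drift N (z r)) volume 0 (σ / K) :=
      (hYc.comp hzc).intervalIntegrable _ _
    rw [← rescaleL_apply, ← (rescaleL K).intervalIntegral_comp_comm hint]
    simp only [rescaleL_apply]
  have h3 : ∫ r in (0 : ℝ)..σ, scaledDrift ω₂ lam β γ N K (rescale K (z (r / K))) =
      ∫ r in (0 : ℝ)..σ / K, rescale K (P.drift N (z r)) := by
    have h4 : ∀ r, scaledDrift ω₂ lam β γ N K (rescale K (z (r / K))) =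
        K⁻¹ • rescale K (P.drift N (z (r / K))) := fun r => (inv_smul_rescale_drift hK.ne' _).symm
    simp_rw [h4]
    rw [intervalIntegral.integral_smul, intervalIntegral.inv_smul_integral_comp_div
      (f := fun r => rescale K (P.drift N (z r))), zero_div]
  rw [h1, h2, h3]

end RescaledEquation

/-! ### The region of bounded rescaled data, and the Lipschitz constant of the limit drift there -/

/-- The region `S(Cp, Cd, Cq) = {|p̃_i| ≤ Cp, |q̃_{i+1} - q̃_i| ≤ Cd, lam q̃_i² ≤ Cq}` of rescaled
phase space on which both the rescaled driven path and the limit flow live (bounded momenta and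
bond stretches; positions only through `lam q²`, so that `lam = 0` is allowed). [folklore] -/
def scaleRegion (lam : ℝ) (N : ℕ) (Cp Cd Cq : ℝ) : Set (PhaseSpace N) :=
  {z | (∀ i, |z.2 i| ≤ Cp) ∧ (∀ i : Fin N, ∀ h : i.val + 1 < N, |z.1 ⟨i.val + 1, h⟩ - z.1 i| ≤ Cd) ∧
    ∀ i, lam * z.1 i ^ 2 ≤ Cq}

/-- `|a³ - b³| ≤ (3/2)(a² + b²)|a - b|`. [folklore] -/
theorem abs_pow_three_sub_pow_three_le (a b : ℝ) :
    |a ^ 3 - b ^ 3| ≤ 3 / 2 * (a ^ 2 + b ^ 2) * |a - b| := by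
  have h : a ^ 3 - b ^ 3 = (a ^ 2 + a * b + b ^ 2) * (a - b) := by ring
  rw [h, abs_mul]
  refine mul_le_mul_of_nonneg_right ?_ (abs_nonneg _)
  rw [abs_le]
  constructor <;> nlinarith [sq_nonneg (a + b), sq_nonneg (a - b)]

section Lipschitz

variable {lam β : ℝ}

/-- **The limit drift is Lipschitz on the region** `S(Cp, Cd, Cq)` (sup norm), with constant
`L = 1 + 3Cq + 12βCd²` (`β ≥ 0`, `lam ≥ 0`). [folklore] -/
theorem lipschitzOnWith_limitChain_drift (hl : 0 ≤ lam) (hβ : 0 ≤ β) {Cp Cd Cq : ℝ} (hCq : 0 ≤ Cq) :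
    LipschitzOnWith (Real.toNNReal (1 + 3 * Cq + 12 * β * Cd ^ 2)) ((limitChain lam β).drift N)
      (scaleRegion lam N Cp Cd Cq) := by
  set L := 1 + 3 * Cq + 12 * β * Cd ^ 2 with hL
  have hL0 : 0 ≤ L := by positivity
  have hL1 : 1 ≤ L := by
    have : 0 ≤ 3 * Cq + 12 * β * Cd ^ 2 := by positivity
    linarith
  have hUd : Differentiable ℝ (limitChain lam β).U :=
    (limitChain_contDiff_U lam β (n := 1)).differentiable one_ne_zero
  have hVd : Differentiable ℝ (limitChain lam β).V :=
    (limitChain_contDiff_V lam β (n := 1)).differentiable one_ne_zero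
  refine LipschitzOnWith.of_dist_le_mul fun z hz z' hz' => ?_
  rw [Real.coe_toNNReal _ hL0, dist_eq_norm, dist_eq_norm]
  have hzz : ∀ i, |z.1 i - z'.1 i| ≤ ‖z - z'‖ := fun i => by
    rw [← Real.norm_eq_abs]
    exact (norm_le_pi_norm (z - z').1 i).trans (norm_fst_le _)
  have hpp : ∀ i, |z.2 i - z'.2 i| ≤ ‖z - z'‖ := fun i => by
    rw [← Real.norm_eq_abs]
    exact (norm_le_pi_norm (z - z').2 i).trans (norm_snd_le _)
  -- the force components
  have hF : ∀ i, |(limitChain lam β).dPotential N i z.1 - (limitChain lam β).dPotential N i z'.1| ≤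
      (3 * Cq + 12 * β * Cd ^ 2) * ‖z - z'‖ := by
    intro i
    rw [limitChain_dPotential_eq, limitChain_dPotential_eq]
    set A := (if h : 0 < i.val then β * (z.1 i - z.1 ⟨i.val - 1, by omega⟩) ^ 3 else 0) with hA
    set A' := (if h : 0 < i.val then β * (z'.1 i - z'.1 ⟨i.val - 1, by omega⟩) ^ 3 else 0) with hA'
    set B := (if h : i.val + 1 < N then β * (z.1 ⟨i.val + 1, h⟩ - z.1 i) ^ 3 else 0) with hB
    set B' := (if h : i.val + 1 < N then β * (z'.1 ⟨i.val + 1, h⟩ - z'.1 i) ^ 3 else 0) with hB'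
    -- pinning term
    have h1 : |lam * z.1 i ^ 3 - lam * z'.1 i ^ 3| ≤ 3 * Cq * ‖z - z'‖ := by
      rw [← mul_sub, abs_mul, abs_of_nonneg hl]
      calc lam * |z.1 i ^ 3 - z'.1 i ^ 3|
          ≤ lam * (3 / 2 * (z.1 i ^ 2 + z'.1 i ^ 2) * |z.1 i - z'.1 i|) :=
            mul_le_mul_of_nonneg_left (abs_pow_three_sub_pow_three_le _ _) hl
        _ = 3 / 2 * (lam * z.1 i ^ 2 + lam * z'.1 i ^ 2) * |z.1 i - z'.1 i| := by ring
        _ ≤ 3 / 2 * (Cq + Cq) * ‖z - z'‖ :=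
            mul_le_mul (by nlinarith [hz.2.2 i, hz'.2.2 i]) (hzz i) (abs_nonneg _) (by positivity)
        _ = 3 * Cq * ‖z - z'‖ := by ring
    -- a bond term
    have hbond : ∀ (r r' : ℝ), |r| ≤ Cd → |r'| ≤ Cd → |r - r'| ≤ 2 * ‖z - z'‖ →
        |β * r ^ 3 - β * r' ^ 3| ≤ 6 * β * Cd ^ 2 * ‖z - z'‖ := by
      intro r r' hr hr' hrr
      rw [← mul_sub, abs_mul, abs_of_nonneg hβ]
      have hr2 : r ^ 2 ≤ Cd ^ 2 := by rw [← sq_abs]; exact pow_le_pow_left₀ (abs_nonneg _) hr 2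
      have hr2' : r' ^ 2 ≤ Cd ^ 2 := by rw [← sq_abs]; exact pow_le_pow_left₀ (abs_nonneg _) hr' 2
      calc β * |r ^ 3 - r' ^ 3| ≤ β * (3 / 2 * (r ^ 2 + r' ^ 2) * |r - r'|) :=
            mul_le_mul_of_nonneg_left (abs_pow_three_sub_pow_three_le _ _) hβ
        _ ≤ β * (3 / 2 * (Cd ^ 2 + Cd ^ 2) * (2 * ‖z - z'‖)) := by
            refine mul_le_mul_of_nonneg_left ?_ hβ
            exact mul_le_mul (by nlinarith) hrr (abs_nonneg _) (by positivity)
        _ = 6 * β * Cd ^ 2 * ‖z - z'‖ := by ring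
    -- left bond
    have h2 : |A - A'| ≤ 6 * β * Cd ^ 2 * ‖z - z'‖ := by
      by_cases hi : 0 < i.val
      · rw [hA, hA', dif_pos hi, dif_pos hi]
        have hb := hz.2.1 ⟨i.val - 1, by omega⟩ (by simp only; omega)
        have hb' := hz'.2.1 ⟨i.val - 1, by omega⟩ (by simp only; omega)
        have heq : (⟨(⟨i.val - 1, by omega⟩ : Fin N).val + 1, by simp only; omega⟩ : Fin N) = i := by
          ext; simp only; omega
        rw [heq] at hb hb'
        refine hbond _ _ hb hb' ?_
        calc |z.1 i - z.1 ⟨i.val - 1, by omega⟩ - (z'.1 i - z'.1 ⟨i.val - 1, by omega⟩)|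
            = |(z.1 i - z'.1 i) - (z.1 ⟨i.val - 1, by omega⟩ - z'.1 ⟨i.val - 1, by omega⟩)| := by ring_nf
          _ ≤ |z.1 i - z'.1 i| + |z.1 ⟨i.val - 1, by omega⟩ - z'.1 ⟨i.val - 1, by omega⟩| := abs_sub _ _
          _ ≤ ‖z - z'‖ + ‖z - z'‖ := add_le_add (hzz _) (hzz _)
          _ = 2 * ‖z - z'‖ := by ring
      · rw [hA, hA', dif_neg hi, dif_neg hi, sub_zero, abs_zero]
        positivity
    -- right bond
    have h3 : |B - B'| ≤ 6 * β * Cd ^ 2 * ‖z - z'‖ := by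
      by_cases hi : i.val + 1 < N
      · rw [hB, hB', dif_pos hi, dif_pos hi]
        refine hbond _ _ (hz.2.1 i hi) (hz'.2.1 i hi) ?_
        calc |z.1 ⟨i.val + 1, hi⟩ - z.1 i - (z'.1 ⟨i.val + 1, hi⟩ - z'.1 i)|
            = |(z.1 ⟨i.val + 1, hi⟩ - z'.1 ⟨i.val + 1, hi⟩) - (z.1 i - z'.1 i)| := by ring_nf
          _ ≤ |z.1 ⟨i.val + 1, hi⟩ - z'.1 ⟨i.val + 1, hi⟩| + |z.1 i - z'.1 i| := abs_sub _ _
          _ ≤ ‖z - z'‖ + ‖z - z'‖ := add_le_add (hzz _) (hzz _)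
          _ = 2 * ‖z - z'‖ := by ring
      · rw [hB, hB', dif_neg hi, dif_neg hi, sub_zero, abs_zero]
        positivity
    have e : lam * z.1 i ^ 3 + A - B - (lam * z'.1 i ^ 3 + A' - B') =
        (lam * z.1 i ^ 3 - lam * z'.1 i ^ 3) + (A - A') - (B - B') := by ring
    rw [e]
    calc |(lam * z.1 i ^ 3 - lam * z'.1 i ^ 3) + (A - A') - (B - B')|
        ≤ |lam * z.1 i ^ 3 - lam * z'.1 i ^ 3| + |A - A'| + |B - B'| :=
          (abs_sub _ _).trans (add_le_add (abs_add_le _ _) le_rfl)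
      _ ≤ 3 * Cq * ‖z - z'‖ + 6 * β * Cd ^ 2 * ‖z - z'‖ + 6 * β * Cd ^ 2 * ‖z - z'‖ :=
          add_le_add (add_le_add h1 h2) h3
      _ = (3 * Cq + 12 * β * Cd ^ 2) * ‖z - z'‖ := by ring
  -- assemble the sup norm
  rw [Prod.norm_def, max_le_iff]
  constructor
  · -- position component of the drift difference: `p - p'`
    refine (pi_norm_le_iff_of_nonneg (by positivity)).2 fun i => ?_
    simp only [Prod.fst_sub, Pi.sub_apply, OscillatorChain.drift, Real.norm_eq_abs]
    calc |z.2 i - z'.2 i| ≤ ‖z - z'‖ := hpp i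
      _ = 1 * ‖z - z'‖ := (one_mul _).symm
      _ ≤ L * ‖z - z'‖ := mul_le_mul_of_nonneg_right hL1 (norm_nonneg _)
  · refine (pi_norm_le_iff_of_nonneg (by positivity)).2 fun i => ?_
    have hγ : (limitChain lam β).γ = 0 := rfl
    simp only [Prod.snd_sub, Pi.sub_apply, OscillatorChain.drift, hγ, zero_mul, sub_zero, Real.norm_eq_abs,
      (limitChain lam β).partialQ_hamiltonian_eq_dPotential hUd hVd]
    calc |-(limitChain lam β).dPotential N i z.1 - -(limitChain lam β).dPotential N i z'.1|
        = |(limitChain lam β).dPotential N i z.1 - (limitChain lam β).dPotential N i z'.1| := by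
          rw [← abs_neg]; ring_nf
      _ ≤ (3 * Cq + 12 * β * Cd ^ 2) * ‖z - z'‖ := hF i
      _ ≤ L * ‖z - z'‖ := by
          refine mul_le_mul_of_nonneg_right ?_ (norm_nonneg _)
          linarith

end Lipschitz

/-! ### The perturbation: rescaled drift minus limit drift is `O(1/K)` -/

section Perturbation

variable {ω₂ lam β γ : ℝ}

/-- The rescaled force minus the limit force: `∂Φ̃_ε/∂q_i - ∂Φ̂/∂q_i = ε(ω₂q_i + [1≤i](q_i - q_{i-1})
- [i+1<N](q_{i+1} - q_i))` — only the harmonic parts survive, with the small factor `ε = K⁻²`.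
[cite: CuneoEckmannHairerReyBellet2018, Lemma 5.13] -/
theorem scaledChain_dPotential_sub_limitChain (ε : ℝ) (i : Fin N) (q : Fin N → ℝ) :
    (scaledChain ω₂ lam β ε).dPotential N i q - (limitChain lam β).dPotential N i q =
      ε * (ω₂ * q i + (if h : 0 < i.val then q i - q ⟨i.val - 1, by omega⟩ else 0) -
        (if h : i.val + 1 < N then q ⟨i.val + 1, h⟩ - q i else 0)) := by
  rw [(scaledChain ω₂ lam β ε).dPotential_eq_closed, limitChain_dPotential_eq, scaledChain_deriv_U]
  simp only [scaledChain_deriv_V]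
  split_ifs <;> ring

/-- The rescaled drift `Ỹ_K` is continuous. [folklore] -/
theorem continuous_scaledDrift (ω₂ lam β γ : ℝ) (N : ℕ) (K : ℝ) :
    Continuous (scaledDrift ω₂ lam β γ N K) := by
  have hF : ∀ i, Continuous fun z : PhaseSpace N => (scaledChain ω₂ lam β (K ^ 2)⁻¹).dPotential N i z.1 :=
    fun i => ((scaledChain ω₂ lam β (K ^ 2)⁻¹).contDiff_dPotential (scaledChain_contDiff_U ω₂ lam β _)
      (scaledChain_contDiff_V ω₂ lam β _) N i).continuous.comp continuous_fst
  unfold scaledDrift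
  refine continuous_snd.prodMk (continuous_pi fun i => ?_)
  exact (hF i).neg.sub (continuous_const.mul ((continuous_apply i).comp continuous_snd))

/-- `t⁴ ≤ A` forces `|t| ≤ max 1 A`. [folklore] -/
theorem abs_le_max_one_of_pow_four_le {t A : ℝ} (h : t ^ 4 ≤ A) : |t| ≤ max 1 A := by
  rcases le_or_gt |t| 1 with h1 | h1
  · exact h1.trans (le_max_left _ _)
  · refine le_max_of_le_right ?_
    calc |t| ≤ |t| ^ 4 := le_self_pow₀ h1.le (by norm_num)
      _ = t ^ 4 := Even.pow_abs (by decide) t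
      _ ≤ A := h

/-- **The perturbation is `O(1/K)`**: on data with `|p̃_i| ≤ Cp`, bond stretches `≤ Cd` and
`ω₂q̃_i² ≤ 2c₁K²` (the rescaled harmonic pinning energy, NOT small when `lam = 0`, but its FORCE
`K⁻²ω₂q̃_i` is), `‖Ỹ_K(z̃) - Ŷ(z̃)‖ ≤ (2c₁ + ω₂ + 2Cd + 2γCp)/K` (`K ≥ 1`): CEHR (5.12) (`R̃_v → 0`
uniformly on `K̃_E`) and the vanishing friction `γ/K`. [cite: CuneoEckmannHairerReyBellet2018, Lemma 5.13 and eq. (5.12)] -/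
theorem norm_scaledDrift_sub_drift_le (hω : 0 ≤ ω₂) (hγ : 0 ≤ γ) {K : ℝ} (hK : 1 ≤ K)
    {Cp Cd c₁ : ℝ} (hCp : 0 ≤ Cp) (hCd : 0 ≤ Cd) (hc₁ : 0 ≤ c₁) {z : PhaseSpace N}
    (hp : ∀ i, |z.2 i| ≤ Cp)
    (hd : ∀ i : Fin N, ∀ h : i.val + 1 < N, |z.1 ⟨i.val + 1, h⟩ - z.1 i| ≤ Cd)
    (hq : ∀ i, ω₂ * z.1 i ^ 2 ≤ 2 * c₁ * K ^ 2) :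
    ‖scaledDrift ω₂ lam β γ N K z - (limitChain lam β).drift N z‖ ≤
      (2 * c₁ + ω₂ + 2 * Cd + 2 * γ * Cp) / K := by
  have hK0 : 0 < K := by linarith
  have hUd : Differentiable ℝ (limitChain lam β).U :=
    (limitChain_contDiff_U lam β (n := 1)).differentiable one_ne_zero
  have hVd : Differentiable ℝ (limitChain lam β).V :=
    (limitChain_contDiff_V lam β (n := 1)).differentiable one_ne_zero
  have hγl : (limitChain lam β).γ = 0 := rfl
  have hw0 : ∀ i, 0 ≤ bathWeight N i := fun i => by unfold bathWeight; split_ifs <;> norm_num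
  have hw2 : ∀ i, bathWeight N i ≤ 2 := fun i => by unfold bathWeight; split_ifs <;> norm_num
  have hbound : 0 ≤ (2 * c₁ + ω₂ + 2 * Cd + 2 * γ * Cp) / K := by positivity
  rw [Prod.norm_def]
  refine max_le ?_ ?_
  · have : (scaledDrift ω₂ lam β γ N K z - (limitChain lam β).drift N z).1 = 0 := by
      ext i; simp [scaledDrift, OscillatorChain.drift]
    rw [this, norm_zero]
    exact hbound
  · refine (pi_norm_le_iff_of_nonneg hbound).2 fun i => ?_
    rw [Real.norm_eq_abs]
    have hcomp : (scaledDrift ω₂ lam β γ N K z - (limitChain lam β).drift N z).2 i =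
        -((scaledChain ω₂ lam β (K ^ 2)⁻¹).dPotential N i z.1 - (limitChain lam β).dPotential N i z.1) -
          γ / K * bathWeight N i * z.2 i := by
      simp only [Prod.snd_sub, Pi.sub_apply, scaledDrift, OscillatorChain.drift, hγl, zero_mul, sub_zero,
        (limitChain lam β).partialQ_hamiltonian_eq_dPotential hUd hVd]
      ring
    rw [hcomp, scaledChain_dPotential_sub_limitChain]
    -- the harmonic remainder
    have hL : |(if h : 0 < i.val then z.1 i - z.1 ⟨i.val - 1, by omega⟩ else 0)| ≤ Cd := by
      by_cases hi : 0 < i.val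
      · rw [dif_pos hi]
        have hb := hd ⟨i.val - 1, by omega⟩ (by simp only; omega)
        have heq : (⟨(⟨i.val - 1, by omega⟩ : Fin N).val + 1, by simp only; omega⟩ : Fin N) = i := by
          ext; simp only; omega
        rw [heq] at hb
        exact hb
      · rw [dif_neg hi, abs_zero]; exact hCd
    have hRb : |(if h : i.val + 1 < N then z.1 ⟨i.val + 1, h⟩ - z.1 i else 0)| ≤ Cd := by
      by_cases hi : i.val + 1 < N
      · rw [dif_pos hi]; exact hd i hi
      · rw [dif_neg hi, abs_zero]; exact hCd
    have hq1 : ω₂ * |z.1 i| ≤ (2 * c₁ + ω₂) * K := by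
      have h1 := mul_le_mul_of_nonneg_left (abs_le_sq_div_add_self (z.1 i) hK0) hω
      have h2 : ω₂ * (z.1 i ^ 2 / K + K) = ω₂ * z.1 i ^ 2 / K + ω₂ * K := by ring
      have h3 : ω₂ * z.1 i ^ 2 / K ≤ 2 * c₁ * K ^ 2 / K := div_le_div_of_nonneg_right (hq i) hK0.le
      have h4 : 2 * c₁ * K ^ 2 / K = 2 * c₁ * K := by
        rw [div_eq_iff hK0.ne']; ring
      linarith
    have hfric : |γ / K * bathWeight N i * z.2 i| ≤ 2 * γ * Cp / K := by
      rw [abs_mul, abs_mul, abs_of_nonneg (div_nonneg hγ hK0.le), abs_of_nonneg (hw0 i)]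
      calc γ / K * bathWeight N i * |z.2 i| ≤ γ / K * 2 * Cp := by
            refine mul_le_mul (mul_le_mul_of_nonneg_left (hw2 i) (div_nonneg hγ hK0.le)) (hp i)
              (abs_nonneg _) (by positivity)
        _ = 2 * γ * Cp / K := by ring
    set D := ω₂ * z.1 i + (if h : 0 < i.val then z.1 i - z.1 ⟨i.val - 1, by omega⟩ else 0) -
        (if h : i.val + 1 < N then z.1 ⟨i.val + 1, h⟩ - z.1 i else 0) with hD
    have hDb : |D| ≤ (2 * c₁ + ω₂) * K + 2 * Cd := by
      calc |D| ≤ |ω₂ * z.1 i + (if h : 0 < i.val then z.1 i - z.1 ⟨i.val - 1, by omega⟩ else 0)| +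
            |(if h : i.val + 1 < N then z.1 ⟨i.val + 1, h⟩ - z.1 i else 0)| := abs_sub _ _
        _ ≤ (|ω₂ * z.1 i| + |(if h : 0 < i.val then z.1 i - z.1 ⟨i.val - 1, by omega⟩ else 0)|) +
            |(if h : i.val + 1 < N then z.1 ⟨i.val + 1, h⟩ - z.1 i else 0)| :=
            add_le_add (abs_add_le _ _) le_rfl
        _ ≤ ((2 * c₁ + ω₂) * K + Cd) + Cd := by
            refine add_le_add (add_le_add ?_ hL) hRb
            rw [abs_mul, abs_of_nonneg hω]; exact hq1
        _ = (2 * c₁ + ω₂) * K + 2 * Cd := by ring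
    calc |-((K ^ 2)⁻¹ * D) - γ / K * bathWeight N i * z.2 i|
        ≤ |-((K ^ 2)⁻¹ * D)| + |γ / K * bathWeight N i * z.2 i| := abs_sub _ _
      _ = (K ^ 2)⁻¹ * |D| + |γ / K * bathWeight N i * z.2 i| := by
          rw [abs_neg, abs_mul, abs_of_nonneg (by positivity)]
      _ ≤ (K ^ 2)⁻¹ * ((2 * c₁ + ω₂) * K + 2 * Cd) + 2 * γ * Cp / K :=
          add_le_add (mul_le_mul_of_nonneg_left hDb (by positivity)) hfric
      _ ≤ (2 * c₁ + ω₂ + 2 * Cd + 2 * γ * Cp) / K := by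
          have e1 : (K ^ 2)⁻¹ * ((2 * c₁ + ω₂) * K + 2 * Cd) = (2 * c₁ + ω₂) / K + 2 * Cd / K ^ 2 := by
            field_simp
          have e2 : (2 * c₁ + ω₂ + 2 * Cd + 2 * γ * Cp) / K =
              (2 * c₁ + ω₂) / K + 2 * Cd / K + 2 * γ * Cp / K := by ring
          have h5 : 2 * Cd / K ^ 2 ≤ 2 * Cd / K :=
            div_le_div_of_nonneg_left (by positivity) hK0 (by nlinarith)
          rw [e1, e2]
          linarith

end Perturbation

/-! ### Translations (for `lam = 0` the limit system is translation invariant) -/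

/-- The translation vector `(c·𝟙, 0)` of phase space. [folklore] -/
def shiftVec (N : ℕ) (c : ℝ) : PhaseSpace N := (fun _ => c, 0)

section Shift

variable {lam β : ℝ}

/-- Momenta are unchanged by a translation of the positions. [folklore] -/
@[simp] theorem shiftVec_snd (c : ℝ) (z : PhaseSpace N) (i : Fin N) : (z + shiftVec N c).2 i = z.2 i := by
  simp [shiftVec]

/-- Positions are shifted by `c`. [folklore] -/
@[simp] theorem shiftVec_fst (c : ℝ) (z : PhaseSpace N) (i : Fin N) : (z + shiftVec N c).1 i = z.1 i + c := by
  simp [shiftVec]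

/-- The limit force is translation invariant when `lam · c = 0`. [folklore] -/
theorem limitChain_dPotential_shift {c : ℝ} (hc : lam * c = 0) (i : Fin N) (q : Fin N → ℝ) :
    (limitChain lam β).dPotential N i (fun j => q j + c) = (limitChain lam β).dPotential N i q := by
  rw [limitChain_dPotential_eq, limitChain_dPotential_eq]
  have h1 : lam * (q i + c) ^ 3 = lam * q i ^ 3 := by
    rcases mul_eq_zero.1 hc with h | h
    · simp [h]
    · simp [h]
  simp only [add_sub_add_right_eq_sub, h1]

/-- The limit drift is translation invariant when `lam · c = 0`. [folklore] -/
theorem limitChain_drift_shift {c : ℝ} (hc : lam * c = 0) (z : PhaseSpace N) :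
    (limitChain lam β).drift N (z + shiftVec N c) = (limitChain lam β).drift N z := by
  have hUd : Differentiable ℝ (limitChain lam β).U :=
    (limitChain_contDiff_U lam β (n := 1)).differentiable one_ne_zero
  have hVd : Differentiable ℝ (limitChain lam β).V :=
    (limitChain_contDiff_V lam β (n := 1)).differentiable one_ne_zero
  rw [(limitChain lam β).drift_eq hUd hVd]
  have h1 : (z + shiftVec N c).1 = fun j => z.1 j + c := by ext j; simp [shiftVec]
  have h2 : (z + shiftVec N c).2 = z.2 := by ext j; simp [shiftVec]
  simp only [h1, h2, limitChain_dPotential_shift hc]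

/-- The limit energy is translation invariant when `lam · c = 0`. [folklore] -/
theorem limitChain_hamiltonian_shift {c : ℝ} (hc : lam * c = 0) (z : PhaseSpace N) :
    (limitChain lam β).hamiltonian N (z + shiftVec N c) = (limitChain lam β).hamiltonian N z := by
  unfold OscillatorChain.hamiltonian
  simp only [shiftVec_snd, shiftVec_fst]
  congr 1
  · refine Finset.sum_congr rfl fun i _ => ?_
    simp only [limitChain]
    rcases mul_eq_zero.1 hc with h | h
    · simp [h]
    · simp [h]
  · refine Finset.sum_congr rfl fun i _ => Finset.sum_congr rfl fun j _ => ?_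
    split_ifs
    · simp only [limitChain]; ring
    · rfl

end Shift

/-! ### Elementary energy bounds for the limit chain, and the size of the constants -/

section Bounds

variable {lam β : ℝ}

/-- A single quartic pinning energy is bounded by the limit energy: `lam q_i⁴/4 ≤ Ĥ` (`lam, β ≥ 0`).
[folklore] -/
theorem limitChain_U_le_hamiltonian (hl : 0 ≤ lam) (hβ : 0 ≤ β) (N : ℕ) (x : PhaseSpace N) (i : Fin N) :
    lam * x.1 i ^ 4 / 4 ≤ (limitChain lam β).hamiltonian N x := by
  unfold OscillatorChain.hamiltonian
  have h1 : lam * x.1 i ^ 4 / 4 ≤ ∑ k, (x.2 k ^ 2 / 2 + (limitChain lam β).U (x.1 k)) := by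
    calc lam * x.1 i ^ 4 / 4 ≤ x.2 i ^ 2 / 2 + (limitChain lam β).U (x.1 i) := by
          simp only [limitChain]; nlinarith [sq_nonneg (x.2 i)]
      _ ≤ ∑ k, (x.2 k ^ 2 / 2 + (limitChain lam β).U (x.1 k)) :=
          Finset.single_le_sum (f := fun k => x.2 k ^ 2 / 2 + (limitChain lam β).U (x.1 k))
            (fun k _ => by simp only [limitChain]; positivity) (Finset.mem_univ i)
  have h2 : 0 ≤ ∑ k : Fin N, ∑ l : Fin N,
      (if l.val = k.val + 1 then (limitChain lam β).V (x.1 l - x.1 k) else 0) :=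
    Finset.sum_nonneg fun k _ => Finset.sum_nonneg fun l _ => by
      split_ifs
      · simp only [limitChain]; positivity
      · exact le_rfl
  linarith

/-- A single bond energy is bounded by the limit energy: `β(q_j - q_i)⁴/4 ≤ Ĥ` for `j = i+1`
(`lam, β ≥ 0`). [folklore] -/
theorem limitChain_bond_le_hamiltonian (hl : 0 ≤ lam) (hβ : 0 ≤ β) (N : ℕ) (x : PhaseSpace N)
    {i j : Fin N} (hj : j.val = i.val + 1) :
    β * (x.1 j - x.1 i) ^ 4 / 4 ≤ (limitChain lam β).hamiltonian N x := by
  unfold OscillatorChain.hamiltonian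
  have h1 : 0 ≤ ∑ k, (x.2 k ^ 2 / 2 + (limitChain lam β).U (x.1 k)) :=
    Finset.sum_nonneg fun k _ => by simp only [limitChain]; positivity
  have hnn : ∀ k l : Fin N,
      0 ≤ (if l.val = k.val + 1 then (limitChain lam β).V (x.1 l - x.1 k) else 0) := by
    intro k l
    split_ifs
    · simp only [limitChain]; positivity
    · exact le_rfl
  have h2 : (limitChain lam β).V (x.1 j - x.1 i) ≤ ∑ k : Fin N, ∑ l : Fin N,
      (if l.val = k.val + 1 then (limitChain lam β).V (x.1 l - x.1 k) else 0) := by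
    calc (limitChain lam β).V (x.1 j - x.1 i)
        = (if j.val = i.val + 1 then (limitChain lam β).V (x.1 j - x.1 i) else 0) := by rw [if_pos hj]
      _ ≤ ∑ l : Fin N, (if l.val = i.val + 1 then (limitChain lam β).V (x.1 l - x.1 i) else 0) :=
          Finset.single_le_sum (f := fun l => if l.val = i.val + 1 then
            (limitChain lam β).V (x.1 l - x.1 i) else 0) (fun l _ => hnn i l) (Finset.mem_univ j)
      _ ≤ ∑ k : Fin N, ∑ l : Fin N,
          (if l.val = k.val + 1 then (limitChain lam β).V (x.1 l - x.1 k) else 0) :=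
          Finset.single_le_sum (f := fun k => ∑ l : Fin N, if l.val = k.val + 1 then
            (limitChain lam β).V (x.1 l - x.1 k) else 0) (fun k _ => Finset.sum_nonneg fun l _ => hnn k l)
            (Finset.mem_univ i)
  have hV : (limitChain lam β).V (x.1 j - x.1 i) = β * (x.1 j - x.1 i) ^ 4 / 4 := rfl
  linarith

/-- The limit energy is dominated by the rescaled energy: `Ĥ ≤ H̃_ε` for `ε, ω₂ ≥ 0` (the rescaled
Hamiltonian adds the nonnegative harmonic parts `εω₂q²/2`, `ε r²/2`). [folklore] -/
theorem limitChain_hamiltonian_le_scaled {ω₂ ε : ℝ} (hω : 0 ≤ ω₂) (hε : 0 ≤ ε) (N : ℕ) (x : PhaseSpace N) :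
    (limitChain lam β).hamiltonian N x ≤ (scaledChain ω₂ lam β ε).hamiltonian N x := by
  unfold OscillatorChain.hamiltonian
  refine add_le_add (Finset.sum_le_sum fun i _ => ?_)
    (Finset.sum_le_sum fun i _ => Finset.sum_le_sum fun j _ => ?_)
  · simp only [limitChain, scaledChain]
    have : 0 ≤ ε * ω₂ * x.1 i ^ 2 / 2 := by positivity
    linarith
  · split_ifs
    · simp only [limitChain, scaledChain]
      have : 0 ≤ ε * (x.1 j - x.1 i) ^ 2 / 2 := by positivity
      linarith
    · exact le_rfl

/-- `c₁ ≥ 6`. [folklore] -/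
theorem six_le_pinnedChainScaleC {ω₂ γ : ℝ} (hω : 0 ≤ ω₂) (hl : 0 ≤ lam) (hβ : 0 ≤ β) (hγ : 0 ≤ γ)
    (N : ℕ) : 6 ≤ pinnedChainScaleC ω₂ lam β γ N := by
  unfold pinnedChainScaleC
  have hA : 0 < pinnedChainScaleA γ N := lt_of_lt_of_le one_pos (one_le_pinnedChainScaleA hγ N)
  have hB := pinnedChainScaleB_nonneg hω hl hβ hγ N
  have : 0 ≤ pinnedChainScaleB ω₂ lam β γ N / pinnedChainScaleA γ N := by positivity
  linarith

/-- `b²/2 - (a - b)² ≤ a²`. [folklore] -/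
theorem half_sq_sub_sq_le (a b : ℝ) : b ^ 2 / 2 - (a - b) ^ 2 ≤ a ^ 2 := by
  nlinarith [sq_nonneg (2 * a - b)]

/-- Telescoping: if consecutive positions differ by at most `D` then `|q_i - q_0| ≤ i · D`.
[folklore] -/
theorem abs_sub_head_le {q : Fin N → ℝ} {D : ℝ} (hN : 0 < N)
    (hd : ∀ i : Fin N, ∀ h : i.val + 1 < N, |q ⟨i.val + 1, h⟩ - q i| ≤ D) :
    ∀ i : Fin N, |q i - q ⟨0, hN⟩| ≤ i.val * D := by
  intro i
  obtain ⟨k, hk⟩ := i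
  induction k with
  | zero => simp
  | succ k ih =>
    have hk' : k < N := by omega
    have h1 := ih hk'
    have h2 := hd ⟨k, hk'⟩ hk
    calc |q ⟨k + 1, hk⟩ - q ⟨0, hN⟩| = |(q ⟨k + 1, hk⟩ - q ⟨k, hk'⟩) + (q ⟨k, hk'⟩ - q ⟨0, hN⟩)| := by ring_nf
      _ ≤ |q ⟨k + 1, hk⟩ - q ⟨k, hk'⟩| + |q ⟨k, hk'⟩ - q ⟨0, hN⟩| := abs_add_le _ _
      _ ≤ D + k * D := add_le_add h2 h1
      _ = ((k + 1 : ℕ) : ℝ) * D := by push_cast; ring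

end Bounds

/-! ### The rescaled driven path lives in the region (energy ceiling), and so does the reference -/

section DrivenPath

variable {ω₂ lam β γ : ℝ} (hω : 0 < ω₂) (hl : 0 ≤ lam) (hβ : 0 < β) (hγ : 0 ≤ γ) (N : ℕ)
include hω hl hβ hγ

/-- **Bounds along the rescaled driven path** `z̃(σ) = rescale K (z(σ/K))`, `σ ∈ [0, Λ]`, from the
energy ceiling `H(y) ≤ c₁K⁴` of `LangevinChainEnergyScale.lean` (`H(x) ≤ 2K⁴`, `‖η‖ ≤ δ₀K` on
`[0, Λ/K]`, `δ₀ ≤ 1`, `Aδ₀Λ ≤ 1`, `K ≥ 1`): rescaled momenta `≤ c₁ + 3/2`, bond stretches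
`≤ max(1, 4c₁/β)`, `lam q̃² ≤ lam + 4c₁`, `ω₂q̃² ≤ 2c₁K²`, and the rescaled momentum differs from
the rescaled smooth momentum `K⁻²ȳ` by at most `δ₀/K` (CEHR (5.9): `z̃_σ ∈ K̃_E` on the event `Ã`;
here pathwise and unconditionally, the noise being small). [cite: CuneoEckmannHairerReyBellet2018, Lemma 5.10 and eq. (5.9)] -/
theorem scalePath_bounds {K : ℝ} (hK : 1 ≤ K) (x : PhaseSpace N)
    (hx : (pinnedChain ω₂ lam β γ).hamiltonian N x ≤ 2 * K ^ 4)
    {η : ℝ → Fin N → ℝ} (hη : Continuous η) {Λ δ₀ : ℝ} (hδ₁ : δ₀ ≤ 1)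
    (hM : ∀ s ∈ Icc 0 (Λ / K), ‖η s‖ ≤ δ₀ * K) (hAδ : pinnedChainScaleA γ N * δ₀ * Λ ≤ 1)
    {σ : ℝ} (hσ : σ ∈ Icc 0 Λ) :
    (∀ i, |(scalePath K ((pinnedChain ω₂ lam β γ).chainFlow N x η) σ).2 i| ≤
        pinnedChainScaleC ω₂ lam β γ N + 3 / 2) ∧
    (∀ i : Fin N, ∀ h : i.val + 1 < N,
        |(scalePath K ((pinnedChain ω₂ lam β γ).chainFlow N x η) σ).1 ⟨i.val + 1, h⟩ -
          (scalePath K ((pinnedChain ω₂ lam β γ).chainFlow N x η) σ).1 i| ≤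
        max 1 (4 * pinnedChainScaleC ω₂ lam β γ N / β)) ∧
    (∀ i, lam * (scalePath K ((pinnedChain ω₂ lam β γ).chainFlow N x η) σ).1 i ^ 2 ≤
        lam + 4 * pinnedChainScaleC ω₂ lam β γ N) ∧
    (∀ i, ω₂ * (scalePath K ((pinnedChain ω₂ lam β γ).chainFlow N x η) σ).1 i ^ 2 ≤
        2 * pinnedChainScaleC ω₂ lam β γ N * K ^ 2) ∧
    (∀ i, |(scalePath K ((pinnedChain ω₂ lam β γ).chainFlow N x η) σ).2 i -
        (K ^ 2)⁻¹ * ((pinnedChain ω₂ lam β γ).chainFlow N x η (σ / K) -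
          ((0 : Fin N → ℝ), η (σ / K))).2 i| ≤ δ₀ / K) := by
  set P := pinnedChain ω₂ lam β γ with hP
  set c₁ := pinnedChainScaleC ω₂ lam β γ N with hc₁
  set z := P.chainFlow N x η with hz
  set s := σ / K with hs
  have hK0 : 0 < K := by linarith
  have hΛ : 0 ≤ Λ := hσ.1.trans hσ.2
  have hsI : s ∈ Icc 0 (Λ / K) := ⟨div_nonneg hσ.1 hK0.le, div_le_div_of_nonneg_right hσ.2 hK0.le⟩
  have hδ0 : 0 ≤ δ₀ := by
    have := (norm_nonneg _).trans (hM 0 ⟨le_rfl, div_nonneg hΛ hK0.le⟩)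
    nlinarith
  have hAMT : pinnedChainScaleA γ N * (δ₀ * K) * (Λ / K) ≤ K := by
    have : pinnedChainScaleA γ N * (δ₀ * K) * (Λ / K) = pinnedChainScaleA γ N * δ₀ * Λ := by
      field_simp
    rw [this]
    exact hAδ.trans hK
  set y := z s - ((0 : Fin N → ℝ), η s) with hy
  have hceil : P.hamiltonian N y ≤ c₁ * K ^ 4 :=
    pinnedChain_hamiltonian_chainFlow_le_ceiling hω hl hβ.le hγ N hK x hx hη hM hAMT s hsI
  have hc6 : 6 ≤ c₁ := six_le_pinnedChainScaleC hω.le hl hβ.le hγ N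
  have hy1 : ∀ j, y.1 j = (z s).1 j := fun j => by simp [hy]
  have hy2 : ∀ j, (z s).2 j = y.2 j + η s j := fun j => by simp [hy]
  have hzs1 : ∀ j, (scalePath K z σ).1 j = K⁻¹ * (z s).1 j := fun j => rfl
  have hzs2 : ∀ j, (scalePath K z σ).2 j = (K ^ 2)⁻¹ * (z s).2 j := fun j => rfl
  have hηi : ∀ j, |η s j| ≤ δ₀ * K := fun j =>
    (show |η s j| ≤ ‖η s‖ by rw [← Real.norm_eq_abs]; exact norm_le_pi_norm (η s) j).trans (hM s hsI)
  refine ⟨fun i => ?_, fun i h => ?_, fun i => ?_, fun i => ?_, fun i => ?_⟩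
  · -- momenta
    rw [hzs2, hy2, abs_mul, abs_of_nonneg (by positivity)]
    have h1 := pinnedChain_abs_momentum_le_scale hω.le hl hβ.le γ N hK0 y i
    have h2 : P.hamiltonian N y / K ^ 2 ≤ c₁ * K ^ 4 / K ^ 2 := div_le_div_of_nonneg_right hceil (by positivity)
    have h3 : c₁ * K ^ 4 / K ^ 2 = c₁ * K ^ 2 := by rw [div_eq_iff (by positivity)]; ring
    have h4 : |y.2 i + η s i| ≤ (c₁ + 1 / 2) * K ^ 2 + K ^ 2 := by
      calc |y.2 i + η s i| ≤ |y.2 i| + |η s i| := abs_add_le _ _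
        _ ≤ (c₁ + 1 / 2) * K ^ 2 + K ^ 2 := by
            refine add_le_add (by linarith) ((hηi i).trans ?_)
            nlinarith
    calc (K ^ 2)⁻¹ * |y.2 i + η s i| ≤ (K ^ 2)⁻¹ * ((c₁ + 1 / 2) * K ^ 2 + K ^ 2) :=
          mul_le_mul_of_nonneg_left h4 (by positivity)
      _ = c₁ + 3 / 2 := by field_simp; ring
  · -- bond stretches
    rw [hzs1, hzs1, ← mul_sub, ← hy1, ← hy1]
    refine abs_le_max_one_of_pow_four_le ?_
    have hb := pinnedChain_bond_le_hamiltonian hω.le hl hβ.le γ N y (i := i) (j := ⟨i.val + 1, h⟩) rfl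
    have hb' : β * (y.1 ⟨i.val + 1, h⟩ - y.1 i) ^ 4 / 4 ≤ c₁ * K ^ 4 := by
      nlinarith [sq_nonneg (y.1 ⟨i.val + 1, h⟩ - y.1 i)]
    rw [mul_pow, inv_pow, ← div_eq_inv_mul, div_le_iff₀ (by positivity), div_mul_eq_mul_div,
      le_div_iff₀ hβ]
    have : (K ^ 4 : ℝ) = (K ^ 4 : ℝ) := rfl
    have hK4 : (K : ℝ) ^ 4 = K ^ 4 := rfl
    nlinarith [hb']
  · -- `lam q̃²`
    rw [hzs1, ← hy1]
    have hU := pinnedChain_U_le_hamiltonian hω.le hl hβ.le γ N y i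
    have hl4 : lam * (K⁻¹ * y.1 i) ^ 4 ≤ 4 * c₁ := by
      rw [mul_pow, inv_pow]
      have : lam * y.1 i ^ 4 ≤ 4 * c₁ * K ^ 4 := by nlinarith [mul_nonneg hω.le (sq_nonneg (y.1 i))]
      calc lam * ((K ^ 4)⁻¹ * y.1 i ^ 4) = lam * y.1 i ^ 4 / K ^ 4 := by ring
        _ ≤ 4 * c₁ * K ^ 4 / K ^ 4 := div_le_div_of_nonneg_right this (by positivity)
        _ = 4 * c₁ := by field_simp
    have hsq : (K⁻¹ * y.1 i) ^ 2 ≤ 1 + (K⁻¹ * y.1 i) ^ 4 := by nlinarith [sq_nonneg ((K⁻¹ * y.1 i) ^ 2 - 1)]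
    nlinarith [mul_le_mul_of_nonneg_left hsq hl]
  · -- harmonic pinning
    rw [hzs1, ← hy1]
    have hU := pinnedChain_U_le_hamiltonian hω.le hl hβ.le γ N y i
    have : ω₂ * y.1 i ^ 2 ≤ 2 * c₁ * K ^ 4 := by nlinarith [mul_nonneg hl (by positivity : (0:ℝ) ≤ y.1 i ^ 4)]
    calc ω₂ * (K⁻¹ * y.1 i) ^ 2 = ω₂ * y.1 i ^ 2 / K ^ 2 := by field_simp
      _ ≤ 2 * c₁ * K ^ 4 / K ^ 2 := div_le_div_of_nonneg_right this (by positivity)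
      _ = 2 * c₁ * K ^ 2 := by rw [div_eq_iff (by positivity)]; ring
  · -- rescaled momentum vs rescaled smooth momentum
    rw [hzs2, hy2]
    have : (K ^ 2)⁻¹ * (y.2 i + η s i) - (K ^ 2)⁻¹ * y.2 i = (K ^ 2)⁻¹ * η s i := by ring
    rw [this, abs_mul, abs_of_nonneg (by positivity)]
    calc (K ^ 2)⁻¹ * |η s i| ≤ (K ^ 2)⁻¹ * (δ₀ * K) := mul_le_mul_of_nonneg_left (hηi i) (by positivity)
      _ = δ₀ / K := by field_simp

end DrivenPath

section Reference

variable {lam β : ℝ}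

/-- **Bounds along the (translated) limit flow** started in the shell `Ĥ ≤ 2`: momenta `≤ 5/2`,
bond stretches `≤ max(1, 8/β)`, `lam q̂² ≤ lam + 8` — by exact energy conservation; a translation
`(c·𝟙, 0)` with `lam·c = 0` does not change them. [folklore] -/
theorem limitChainFlow_shift_bounds (hl : 0 ≤ lam) (hβ : 0 < β) (N : ℕ) {R : ℝ} (hR : 0 < R)
    {x : PhaseSpace N} (hx : (limitChain lam β).hamiltonian N x ≤ 2) {c : ℝ} (hc : lam * c = 0) (σ : ℝ) :
    (∀ i, |(limitChainFlow lam β N hR x σ + shiftVec N c).2 i| ≤ 5 / 2) ∧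
    (∀ i : Fin N, ∀ h : i.val + 1 < N,
        |(limitChainFlow lam β N hR x σ + shiftVec N c).1 ⟨i.val + 1, h⟩ -
          (limitChainFlow lam β N hR x σ + shiftVec N c).1 i| ≤ max 1 (8 / β)) ∧
    (∀ i, lam * (limitChainFlow lam β N hR x σ + shiftVec N c).1 i ^ 2 ≤ lam + 8) := by
  set w := limitChainFlow lam β N hR x σ with hw
  have hH : (limitChain lam β).hamiltonian N w ≤ 2 := by
    rw [hw, limitChain_hamiltonian_limitChainFlow]; exact hx
  refine ⟨fun i => ?_, fun i h => ?_, fun i => ?_⟩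
  · rw [shiftVec_snd]
    have := limitChain_abs_momentum_le hl hβ.le N w i
    linarith
  · rw [shiftVec_fst, shiftVec_fst, add_sub_add_right_eq_sub]
    refine abs_le_max_one_of_pow_four_le ?_
    have hb := limitChain_bond_le_hamiltonian hl hβ.le N w (i := i) (j := ⟨i.val + 1, h⟩) rfl
    rw [le_div_iff₀ hβ]
    nlinarith
  · rw [shiftVec_fst]
    rcases mul_eq_zero.1 hc with h0 | h0
    · rw [h0]; simp
    · rw [h0, add_zero]
      have hU := limitChain_U_le_hamiltonian hl hβ.le N w i
      have h4 : lam * w.1 i ^ 4 ≤ 8 := by linarith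
      have hsq : w.1 i ^ 2 ≤ 1 + w.1 i ^ 4 := by nlinarith [sq_nonneg (w.1 i ^ 2 - 1)]
      nlinarith [mul_le_mul_of_nonneg_left hsq hl]

end Reference

/-! ### The dissipation bound in the interaction regime (CEHR Prop. 5.3, case `H_i ≥ H/2`) -/

section Main

variable {ω₂ lam β γ : ℝ}

set_option maxHeartbeats 1600000 in
/-- **High-energy dissipation over the short window, interaction regime** (CEHR Prop. 5.3 with
§5.1, pathwise): fix `Λ > 0` and a noise size `δ₀ ∈ (0, 1]` with `Aδ₀Λ ≤ 1`. There are `K₀ ≥ 1`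
and `ε > 0` such that for every scale `K ≥ K₀`, every initial condition with `H(x) ≤ 2K⁴` whose
rescaled point has limit energy `Ĥ(rescale K x) ≥ 1/2` (the interaction-dominated regime; for
`lam > 0` automatic at high energy), and every continuous noise path with `‖η‖ ≤ δ₀K` on the
window `[0, Λ/K]`, the dissipation of the smooth part satisfies
`γ ∫₀^{Λ/K} ∑_i w_i ȳ_i(s)² ds ≥ ε K³`. Proof: rescale (`scalePath_eq`); the rescaled path solves the
limit equation up to the forcing `G` with `‖G - x̃‖ ≤ (δ₀ + ΛC)/K` and stays in the region
`S(Cp, Cd, Cq)` (`scalePath_bounds`); the reference limit solution from the (translated, if `lam = 0`)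
rescaled point stays there too and dissipates at least `ε₁` (`exists_le_limitDissipation`,
Prop. 5.14); Grönwall (`IsIntegralSolutionOn.norm_sub_le_mul_exp`, Lemma 5.8/5.17) makes the two
`O(1/K)`-close, so the rescaled path dissipates at least `ε₁/4` for `K` large, i.e. `εK³` in the
original variables. [cite: CuneoEckmannHairerReyBellet2018, Prop 5.3, Lemma 5.17 and eq. (5.9)] -/
theorem pinnedChain_dissipation_ge_interaction (hω : 0 < ω₂) (hl : 0 ≤ lam) (hβ : 0 < β) (hγ : 0 < γ)
    (hN : 0 < N) {Λ δ₀ : ℝ} (hΛ : 0 < Λ) (hδ₀ : 0 < δ₀) (hδ₁ : δ₀ ≤ 1)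
    (hAδ : pinnedChainScaleA γ N * δ₀ * Λ ≤ 1) :
    ∃ K₀ ε : ℝ, 1 ≤ K₀ ∧ 0 < ε ∧ ∀ K : ℝ, K₀ ≤ K → ∀ x : PhaseSpace N,
      (pinnedChain ω₂ lam β γ).hamiltonian N x ≤ 2 * K ^ 4 →
      1 / 2 ≤ (limitChain lam β).hamiltonian N (rescale K x) →
      ∀ η : ℝ → Fin N → ℝ, Continuous η → (∀ s ∈ Icc 0 (Λ / K), ‖η s‖ ≤ δ₀ * K) →
        ε * K ^ 3 ≤ γ * ∫ s in (0 : ℝ)..Λ / K, ∑ i, bathWeight N i *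
          ((pinnedChain ω₂ lam β γ).chainFlow N x η s - ((0 : Fin N → ℝ), η s)).2 i ^ 2 := by
  -- the constants
  set c₁ := pinnedChainScaleC ω₂ lam β γ N with hc₁
  have hc6 : 6 ≤ c₁ := six_le_pinnedChainScaleC hω.le hl hβ.le hγ.le N
  set Cp : ℝ := c₁ + 3 / 2 with hCp
  set Cd : ℝ := max 1 (4 * c₁ / β) with hCd
  set Cq : ℝ := lam + 4 * c₁ with hCq
  have hCp0 : 0 ≤ Cp := by positivity
  have hCd1 : 1 ≤ Cd := le_max_left _ _
  have hCd0 : 0 ≤ Cd := zero_le_one.trans hCd1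
  have hCq0 : 0 ≤ Cq := by positivity
  set L : ℝ := 1 + 3 * Cq + 12 * β * Cd ^ 2 with hL
  have hL0 : 0 ≤ L := by positivity
  set ρ : ℝ := N * Cd + max 1 (8 / lam) with hρ
  have hρ0 : 0 ≤ ρ := by positivity
  set R : ℝ := Real.sqrt (N * ((ρ + (2 + 1 / 2) * Λ) ^ 2 + (2 + 1 / 2) ^ 2)) + 1 with hRdef
  have hR : 0 < R := by positivity
  have hRad : N * ((ρ + (2 + 1 / 2) * Λ) ^ 2 + (2 + 1 / 2) ^ 2) ≤ R ^ 2 := by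
    have h0 : 0 ≤ (N : ℝ) * ((ρ + (2 + 1 / 2) * Λ) ^ 2 + (2 + 1 / 2) ^ 2) := by positivity
    have h1 := Real.sq_sqrt h0
    nlinarith [Real.sqrt_nonneg ((N : ℝ) * ((ρ + (2 + 1 / 2) * Λ) ^ 2 + (2 + 1 / 2) ^ 2))]
  obtain ⟨ε₁, hε₁, hF⟩ := exists_le_limitDissipation (lam := lam) (β := β) N hR hl hβ hN hΛ
    (h₀ := 2) (h₁ := 1 / 2) (ρ := ρ) (by norm_num) hRad
  set Cpert : ℝ := 2 * c₁ + ω₂ + 2 * Cd + 2 * γ * Cp with hCpert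
  have hCpert0 : 0 ≤ Cpert := by positivity
  set D₀ : ℝ := (δ₀ + Λ * Cpert) * Real.exp (L * Λ) + δ₀ with hD₀
  have hD₀0 : 0 ≤ D₀ := by positivity
  set K₀ : ℝ := max 1 (8 * Λ * D₀ ^ 2 / ε₁ + 1) with hK₀
  refine ⟨K₀, γ * ε₁ / 4, le_max_left _ _, by positivity, ?_⟩
  intro K hK x hx hhalf η hη hM
  have hK1 : 1 ≤ K := (le_max_left _ _).trans hK
  have hK0 : 0 < K := by linarith
  have hKD : 8 * Λ * D₀ ^ 2 / ε₁ ≤ K := by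
    have := (le_max_right _ _).trans hK
    linarith
  set P := pinnedChain ω₂ lam β γ with hP
  set z := P.chainFlow N x η with hz
  set xs := rescale K x with hxs
  set zs := scalePath K z with hzs
  set Yhat := (limitChain lam β).drift N with hYhat
  -- (a) the integral equation on the window and its rescaling
  have hzIE : ∀ s ∈ Icc 0 (Λ / K), z s = x + ((0 : Fin N → ℝ), η s) +
      ∫ r in (0 : ℝ)..s, P.drift N (z r) :=
    pinnedChain_isIntegralSolutionOn_chainFlow hω hl hβ.le hγ.le N x hη (Λ / K)
  have hzc : Continuous z := pinnedChain_continuous_chainFlow hω hl hβ.le hγ.le N x hη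
  have hzsc : Continuous zs := continuous_scalePath K hzc
  have hzsIE : ∀ σ ∈ Icc 0 Λ, zs σ = xs + ((0 : Fin N → ℝ), fun i => (K ^ 2)⁻¹ * η (σ / K) i) +
      ∫ r in (0 : ℝ)..σ, scaledDrift ω₂ lam β γ N K (zs r) := fun σ hσ =>
    scalePath_eq hK0 hzc hzIE hσ
  -- (b) bounds along the rescaled path, membership in the region, the perturbation
  have hbd := fun σ (hσ : σ ∈ Icc 0 Λ) =>
    scalePath_bounds hω hl hβ hγ.le N hK1 x hx hη hδ₁ hM hAδ hσ
  have hmem : ∀ σ ∈ Icc 0 Λ, zs σ ∈ scaleRegion lam N Cp Cd Cq := fun σ hσ =>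
    ⟨(hbd σ hσ).1, (hbd σ hσ).2.1, (hbd σ hσ).2.2.1⟩
  have hpert : ∀ σ ∈ Icc 0 Λ, ‖scaledDrift ω₂ lam β γ N K (zs σ) - Yhat (zs σ)‖ ≤ Cpert / K :=
    fun σ hσ => norm_scaledDrift_sub_drift_le hω.le hγ.le hK1 hCp0 hCd0 (by positivity)
      (hbd σ hσ).1 (hbd σ hσ).2.1 (hbd σ hσ).2.2.2.1
  -- (c) the rescaled path solves the limit equation with the forcing `G`
  have hYs : Continuous fun r => scaledDrift ω₂ lam β γ N K (zs r) :=
    (continuous_scaledDrift ω₂ lam β γ N K).comp hzsc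
  have hYh : Continuous fun r => Yhat (zs r) := (limitChain_contDiff_drift lam β N (n := 0)).continuous.comp hzsc
  set G : ℝ → PhaseSpace N := fun σ => xs + ((0 : Fin N → ℝ), fun i => (K ^ 2)⁻¹ * η (σ / K) i) +
    ∫ r in (0 : ℝ)..σ, (scaledDrift ω₂ lam β γ N K (zs r) - Yhat (zs r)) with hG
  have hGIE : IsIntegralSolutionOn Yhat G zs Λ := by
    intro σ hσ
    rw [hG]
    simp only
    rw [intervalIntegral.integral_sub (hYs.intervalIntegrable _ _) (hYh.intervalIntegrable _ _), hzsIE σ hσ]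
    abel
  have hGδ : ∀ σ ∈ Icc 0 Λ, ‖G σ - xs‖ ≤ (δ₀ + Λ * Cpert) / K := by
    intro σ hσ
    have e : G σ - xs = ((0 : Fin N → ℝ), fun i => (K ^ 2)⁻¹ * η (σ / K) i) +
        ∫ r in (0 : ℝ)..σ, (scaledDrift ω₂ lam β γ N K (zs r) - Yhat (zs r)) := by
      rw [hG]; simp only; abel
    rw [e]
    have h1 : ‖(((0 : Fin N → ℝ), fun i => (K ^ 2)⁻¹ * η (σ / K) i) : PhaseSpace N)‖ ≤ δ₀ / K := by
      rw [Prod.norm_def, norm_zero, max_le_iff]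
      refine ⟨by positivity, (pi_norm_le_iff_of_nonneg (by positivity)).2 fun i => ?_⟩
      have := (hbd σ hσ).2.2.2.2 i
      have hcomp : (scalePath K ((pinnedChain ω₂ lam β γ).chainFlow N x η) σ).2 i -
          (K ^ 2)⁻¹ * ((pinnedChain ω₂ lam β γ).chainFlow N x η (σ / K) - ((0 : Fin N → ℝ), η (σ / K))).2 i =
          (K ^ 2)⁻¹ * η (σ / K) i := by
        simp only [scalePath, rescale_snd, Prod.snd_sub, Pi.sub_apply]
        ring
      rw [hcomp] at this
      rwa [Real.norm_eq_abs]
    have h2 : ‖∫ r in (0 : ℝ)..σ, (scaledDrift ω₂ lam β γ N K (zs r) - Yhat (zs r))‖ ≤ Cpert / K * |σ - 0| :=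
      intervalIntegral.norm_integral_le_of_norm_le_const fun r hr => by
        rw [uIoc_of_le hσ.1] at hr
        exact hpert r ⟨hr.1.le, hr.2.trans hσ.2⟩
    rw [sub_zero, abs_of_nonneg hσ.1] at h2
    calc ‖(((0 : Fin N → ℝ), fun i => (K ^ 2)⁻¹ * η (σ / K) i) : PhaseSpace N) +
          ∫ r in (0 : ℝ)..σ, (scaledDrift ω₂ lam β γ N K (zs r) - Yhat (zs r))‖
        ≤ δ₀ / K + Cpert / K * σ := (norm_add_le _ _).trans (add_le_add h1 h2)
      _ ≤ δ₀ / K + Cpert / K * Λ := by gcongr; exact hσ.2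
      _ = (δ₀ + Λ * Cpert) / K := by ring
  -- (d) the reference solution of the limit system, translated if `lam = 0`
  set c : ℝ := if lam = 0 then xs.1 ⟨0, hN⟩ else 0 with hcdef
  have hc : lam * c = 0 := by
    rw [hcdef]; split_ifs with h
    · rw [h, zero_mul]
    · rw [mul_zero]
  set xh : PhaseSpace N := xs + shiftVec N (-c) with hxh
  have hxh_xs : xh + shiftVec N c = xs := by
    rw [hxh]; ext i <;> simp [shiftVec]
  have hHxs : (limitChain lam β).hamiltonian N xs ≤ 2 := by
    have h1 := limitChain_hamiltonian_le_scaled (lam := lam) (β := β) hω.le (ε := (K ^ 2)⁻¹) (by positivity) N xs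
    have h2 := pinnedChain_hamiltonian_eq_scaled ω₂ lam β γ hK0.ne' N x
    have h3 : (scaledChain ω₂ lam β (K ^ 2)⁻¹).hamiltonian N xs ≤ 2 := by
      have hK4 : 0 < K ^ 4 := by positivity
      refine le_of_mul_le_mul_left ?_ hK4
      rw [← h2]
      linarith
    exact h1.trans h3
  have hnc : lam * -c = 0 := by rw [mul_neg, hc, neg_zero]
  have hHxh : (limitChain lam β).hamiltonian N xh = (limitChain lam β).hamiltonian N xs := by
    rw [hxh, limitChain_hamiltonian_shift hnc]
  have hxh2 : (limitChain lam β).hamiltonian N xh ≤ 2 := hHxh ▸ hHxs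
  have hxh1 : 1 / 2 ≤ (limitChain lam β).hamiltonian N xh := hHxh ▸ hhalf
  -- position bound of the gauge-fixed point
  have h0mem : (0 : ℝ) ∈ Icc 0 Λ := ⟨le_rfl, hΛ.le⟩
  have hzs0 : ∀ j, (zs 0).1 j = xs.1 j := fun j => by
    simp only [hzs, scalePath, zero_div, hxs, rescale_fst, hz]
    rw [pinnedChain_chainFlow_of_nonpos ω₂ lam β γ N x hη le_rfl]
    simp
  have hxsd : ∀ i : Fin N, ∀ h : i.val + 1 < N, |xs.1 ⟨i.val + 1, h⟩ - xs.1 i| ≤ Cd := by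
    intro i h
    have := (hbd 0 h0mem).2.1 i h
    rw [← hzs0, ← hzs0]
    exact this
  have hxhρ : ∀ i, |xh.1 i| ≤ ρ := by
    intro i
    rw [hxh, shiftVec_fst]
    by_cases hl0 : lam = 0
    · have hcv : c = xs.1 ⟨0, hN⟩ := by rw [hcdef, if_pos hl0]
      rw [hcv, ← sub_eq_add_neg]
      have ht := abs_sub_head_le hN hxsd i
      calc |xs.1 i - xs.1 ⟨0, hN⟩| ≤ i.val * Cd := ht
        _ ≤ N * Cd := mul_le_mul_of_nonneg_right (by exact_mod_cast i.isLt.le) hCd0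
        _ ≤ ρ := by rw [hρ]; linarith [le_max_left (1 : ℝ) (8 / lam)]
    · have hcv : c = 0 := by rw [hcdef, if_neg hl0]
      rw [hcv, neg_zero, add_zero]
      have hlpos : 0 < lam := lt_of_le_of_ne hl (Ne.symm hl0)
      have hU := limitChain_U_le_hamiltonian hl hβ.le N xs i
      have h4 : xs.1 i ^ 4 ≤ 8 / lam := by
        rw [le_div_iff₀ hlpos]; nlinarith
      calc |xs.1 i| ≤ max 1 (8 / lam) := abs_le_max_one_of_pow_four_le h4
        _ ≤ ρ := by rw [hρ]; linarith [mul_nonneg (Nat.cast_nonneg N) hCd0]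
  set zh : ℝ → PhaseSpace N := fun σ => limitChainFlow lam β N hR xh σ + shiftVec N c with hzh
  have hzhc : Continuous zh := (continuous_limitChainFlow_right lam β N hR xh).add continuous_const
  have hzhIE : IsIntegralSolutionOn Yhat (fun _ => xs) zh Λ := by
    intro σ hσ
    have h1 := limitChainFlow_eq_add_integral N hR hl hβ.le (h₀ := 2) (ρ := ρ) (Λ := Λ) hRad hxh2 hxhρ hσ
    have h2 : ∀ r, Yhat (zh r) = Yhat (limitChainFlow lam β N hR xh r) := fun r => by
      rw [hzh]; exact limitChain_drift_shift hc _
    simp_rw [h2]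
    rw [hzh]
    simp only
    rw [h1, add_assoc, add_comm (∫ r in (0:ℝ)..σ, Yhat (limitChainFlow lam β N hR xh r)) (shiftVec N c),
      ← add_assoc, hxh_xs]
  have hzhmem : ∀ σ ∈ Icc 0 Λ, zh σ ∈ scaleRegion lam N Cp Cd Cq := by
    intro σ _
    have hb := limitChainFlow_shift_bounds hl hβ N hR hxh2 hc σ
    refine ⟨fun i => (hb.1 i).trans (by rw [hCp]; linarith), fun i h => (hb.2.1 i h).trans ?_,
      fun i => (hb.2.2 i).trans (by rw [hCq]; linarith)⟩
    rw [hCd]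
    exact max_le_max le_rfl (div_le_div_of_nonneg_right (by linarith) hβ.le)
  -- (e) Grönwall
  have hLip := lipschitzOnWith_limitChain_drift (N := N) hl hβ.le (Cp := Cp) (Cd := Cd) hCq0
  have hclose : ∀ σ ∈ Icc 0 Λ, ‖zs σ - zh σ‖ ≤ (δ₀ + Λ * Cpert) / K * Real.exp (L * Λ) := by
    intro σ hσ
    have h := IsIntegralSolutionOn.norm_sub_le_mul_exp hLip hGIE hzhIE hzsc hzhc hmem hzhmem
      (δ := (δ₀ + Λ * Cpert) / K) (fun t ht => by simpa using hGδ t ht) σ hσ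
    refine h.trans (mul_le_mul_of_nonneg_left ?_ (by positivity))
    rw [Real.coe_toNNReal _ hL0]
    exact Real.exp_le_exp.2 (mul_le_mul_of_nonneg_left hσ.2 hL0)
  -- (f) dissipation of the reference
  have hFxh : ε₁ ≤ limitDissipation lam β N hR Λ xh := hF xh hxh1 hxh2 hxhρ
  -- (g) transfer to the rescaled smooth momenta `K⁻² ȳ(σ/K)`
  set ys : ℝ → Fin N → ℝ := fun σ i =>
    (K ^ 2)⁻¹ * (z (σ / K) - ((0 : Fin N → ℝ), η (σ / K))).2 i with hys
  have hΔ : ∀ σ ∈ Icc 0 Λ, ∀ i, |ys σ i - (limitChainFlow lam β N hR xh σ).2 i| ≤ D₀ / K := by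
    intro σ hσ i
    have h1 : |(zs σ).2 i - ys σ i| ≤ δ₀ / K := (hbd σ hσ).2.2.2.2 i
    have h2 : |(zs σ).2 i - (zh σ).2 i| ≤ (δ₀ + Λ * Cpert) / K * Real.exp (L * Λ) := by
      have := hclose σ hσ
      calc |(zs σ).2 i - (zh σ).2 i| = |(zs σ - zh σ).2 i| := by simp
        _ ≤ ‖zs σ - zh σ‖ := by
            rw [← Real.norm_eq_abs]; exact (norm_le_pi_norm (zs σ - zh σ).2 i).trans (norm_snd_le _)
        _ ≤ _ := this
    have h3 : (zh σ).2 i = (limitChainFlow lam β N hR xh σ).2 i := by rw [hzh]; exact shiftVec_snd c _ i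
    rw [← h3]
    calc |ys σ i - (zh σ).2 i| = |((zs σ).2 i - (zh σ).2 i) - ((zs σ).2 i - ys σ i)| := by ring_nf
      _ ≤ |(zs σ).2 i - (zh σ).2 i| + |(zs σ).2 i - ys σ i| := abs_sub _ _
      _ ≤ (δ₀ + Λ * Cpert) / K * Real.exp (L * Λ) + δ₀ / K := add_le_add h2 h1
      _ = D₀ / K := by rw [hD₀]; ring
  have hw0 : ∀ i, 0 ≤ bathWeight N i := fun i => by unfold bathWeight; split_ifs <;> norm_num
  have hpt : ∀ σ ∈ Icc 0 Λ, (1 / 2) * (∑ i, bathWeight N i * (limitChainFlow lam β N hR xh σ).2 i ^ 2) -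
      2 * (D₀ / K) ^ 2 ≤ ∑ i, bathWeight N i * ys σ i ^ 2 := by
    intro σ hσ
    have h1 : ∀ i, bathWeight N i * ((limitChainFlow lam β N hR xh σ).2 i ^ 2 / 2 - (D₀ / K) ^ 2) ≤
        bathWeight N i * ys σ i ^ 2 := by
      intro i
      refine mul_le_mul_of_nonneg_left ?_ (hw0 i)
      have h := half_sq_sub_sq_le (ys σ i) ((limitChainFlow lam β N hR xh σ).2 i)
      have hd : (ys σ i - (limitChainFlow lam β N hR xh σ).2 i) ^ 2 ≤ (D₀ / K) ^ 2 := by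
        rw [← sq_abs]; exact pow_le_pow_left₀ (abs_nonneg _) (hΔ σ hσ i) 2
      linarith
    have h2 := Finset.sum_le_sum fun i (_ : i ∈ Finset.univ) => h1 i
    have h3 : ∑ i, bathWeight N i * ((limitChainFlow lam β N hR xh σ).2 i ^ 2 / 2 - (D₀ / K) ^ 2) =
        (1 / 2) * (∑ i, bathWeight N i * (limitChainFlow lam β N hR xh σ).2 i ^ 2) -
          (∑ i, bathWeight N i) * (D₀ / K) ^ 2 := by
      rw [Finset.mul_sum, Finset.sum_mul, ← Finset.sum_sub_distrib]
      exact Finset.sum_congr rfl fun i _ => by ring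
    rw [h3, sum_bathWeight hN] at h2
    exact h2
  -- integrate over `[0, Λ]`
  have hysc : Continuous fun σ => ∑ i, bathWeight N i * ys σ i ^ 2 := by
    have hc1 : Continuous fun σ => z (σ / K) - ((0 : Fin N → ℝ), η (σ / K)) :=
      (hzc.comp (continuous_id.div_const K)).sub
        (continuous_const.prodMk (hη.comp (continuous_id.div_const K)))
    refine continuous_finsetSum _ fun i _ => continuous_const.mul ?_
    exact (continuous_const.mul ((continuous_apply i).comp (continuous_snd.comp hc1))).pow 2
  have hlimc : Continuous fun σ => ∑ i, bathWeight N i * (limitChainFlow lam β N hR xh σ).2 i ^ 2 :=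
    (continuous_limitDissipation_integrand lam β N hR).comp (Continuous.prodMk_right xh)
  have hint : ε₁ / 4 ≤ ∫ σ in (0 : ℝ)..Λ, ∑ i, bathWeight N i * ys σ i ^ 2 := by
    have h1 : ∫ σ in (0 : ℝ)..Λ, ((1 / 2) * (∑ i, bathWeight N i * (limitChainFlow lam β N hR xh σ).2 i ^ 2) -
        2 * (D₀ / K) ^ 2) ≤ ∫ σ in (0 : ℝ)..Λ, ∑ i, bathWeight N i * ys σ i ^ 2 :=
      intervalIntegral.integral_mono_on hΛ.le
        (((hlimc.const_mul _).sub continuous_const).intervalIntegrable _ _)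
        (hysc.intervalIntegrable _ _) fun σ hσ => hpt σ hσ
    rw [intervalIntegral.integral_sub ((hlimc.const_mul _).intervalIntegrable _ _)
      (continuous_const.intervalIntegrable _ _), intervalIntegral.integral_const_mul,
      intervalIntegral.integral_const, sub_zero, smul_eq_mul] at h1
    unfold limitDissipation at hFxh
    -- `2 Λ (D₀/K)² ≤ ε₁/4` from `K ≥ 8ΛD₀²/ε₁` and `K ≥ 1`
    have h3 : Λ * (2 * (D₀ / K) ^ 2) ≤ ε₁ / 4 := by
      have hK2 : K ≤ K ^ 2 := by nlinarith only [hK1]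
      have h4 : 8 * Λ * D₀ ^ 2 ≤ ε₁ * K := by
        have := mul_le_mul_of_nonneg_left hKD hε₁.le
        rwa [mul_div_cancel₀ _ hε₁.ne'] at this
      have h6 : ε₁ * K ≤ ε₁ * K ^ 2 := mul_le_mul_of_nonneg_left hK2 hε₁.le
      rw [div_pow]
      have h5 : Λ * (2 * (D₀ ^ 2 / K ^ 2)) = 2 * Λ * D₀ ^ 2 / K ^ 2 := by ring
      rw [h5, div_le_iff₀ (by positivity)]
      linarith only [h4, h6]
    linarith only [h1, h3, hFxh]
  -- (h) back to the original time: `∫₀^{Λ/K} ∑ w ȳ² = K³ ∫₀^Λ ∑ w (K⁻²ȳ(σ/K))²`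
  have hunscale : ∫ s in (0 : ℝ)..Λ / K, ∑ i, bathWeight N i *
      (z s - ((0 : Fin N → ℝ), η s)).2 i ^ 2 = K ^ 3 * ∫ σ in (0 : ℝ)..Λ, ∑ i, bathWeight N i * ys σ i ^ 2 := by
    have h1 : ∀ σ, ∑ i, bathWeight N i * ys σ i ^ 2 =
        (K ^ 4)⁻¹ * ∑ i, bathWeight N i * (z (σ / K) - ((0 : Fin N → ℝ), η (σ / K))).2 i ^ 2 := by
      intro σ
      rw [Finset.mul_sum]
      refine Finset.sum_congr rfl fun i _ => ?_
      simp only [hys]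
      have : (K ^ 4)⁻¹ = (K ^ 2)⁻¹ * (K ^ 2)⁻¹ := by rw [← mul_inv, ← pow_add]
      rw [this]; ring
    simp_rw [h1]
    rw [intervalIntegral.integral_const_mul,
      intervalIntegral.integral_comp_div (fun s => ∑ i, bathWeight N i *
        (z s - ((0 : Fin N → ℝ), η s)).2 i ^ 2) hK0.ne', zero_div, smul_eq_mul]
    field_simp
  rw [hunscale]
  have hγK : 0 ≤ γ * K ^ 3 := by positivity
  calc γ * ε₁ / 4 * K ^ 3 = γ * K ^ 3 * (ε₁ / 4) := by ring
    _ ≤ γ * K ^ 3 * ∫ σ in (0 : ℝ)..Λ, ∑ i, bathWeight N i * ys σ i ^ 2 :=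
        mul_le_mul_of_nonneg_left hint hγK
    _ = γ * (K ^ 3 * ∫ σ in (0 : ℝ)..Λ, ∑ i, bathWeight N i * ys σ i ^ 2) := by ring

end Main

end Literature.MathematicalPhysics.KineticTheory.HeatConduction
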